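import Literature.Geometry.Kaehler.RiemannianHodgeSmoothProofs
import HarnessLib

/-!
# The harmonic forms are a linear subspace: corrected named fact (Warner (1983), 6.1, Def. 6.7)

Companion of `Literature/Geometry/Kaehler/RiemannianHodge.lean` (§*Smoothness predicates*),
`Literature/Geometry/Kaehler/RiemannianHodgeHarmonic.lean` (the relative discharge
`mem_harmonicForms_iff_of_facts`) and `Literature/Geometry/Kaehler/RiemannianHodgeSmoothProofs.lean`
(the bridge `mem_harmonicForms_iff_of_contMDiffMetric`); it completes the verdict clean-up of the
predicate `Literature.Geometry.Kaehler.mem_harmonicForms_iff` in the format of the three sibling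
corrected facts (`isSmoothForm_hodgeStar_of_isContMDiffRiemannianBundle`,
`isSmoothForm_mcoderiv_of_isContMDiffRiemannianBundle`,
`mcoderiv_mcoderiv_of_isContMDiffRiemannianBundle`), as announced in
`RiemannianHodgeHarmonicRefutation.lean` ("the corrected *closed* named fact … is left to the
restating seat").

`mem_harmonicForms_iff o` records Warner's "`Δ = δd + dδ` … is a linear operator on `E^p(M)`"
(GTM 94, 6.1, p. 220) together with `H^p = {ω ∈ E^p(M) : Δω = 0}` (Def. 6.7, p. 222) as
"`α ∈ harmonicForms o h ↔ IsHarmonicForm o h α`": the `ℝ`-span of the harmonic `k`-forms *is* the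
set of harmonic `k`-forms, i.e. the harmonic forms are closed under `+` and `•`. In Warner a
Riemannian structure is a *smooth* choice of inner products (4.10, p. 149; Ch. 1, Ex. 23), whereas
the predicate's metric is the ambient `[RiemannianBundle (TangentSpace I)]` instance, a fibrewise
family of inner products with no regularity in the base point (its elaborated binders are
`… [ChartedSpace H M] [FiniteDimensional ℝ E] [RiemannianBundle _] {k m} (o)`; the M5 migration had
written it after unused — hence never abstracted — section instances `[IsManifold I ∞ M]
[IsContinuousRiemannianBundle E _] [IsContMDiffRiemannianBundle I ∞ E _]`). Closed over those
binders it is **false** (`RiemannianHodgeRoughMetric.lean`: for `g = a dx² + a⁻¹ dy²` on `ℝ²`,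
`a = exp (x · 𝟙_ℚ(y))` differentiable nowhere, unit determinant so `vol = dx ∧ dy` is smooth, the
smooth functions `y + x²/2` and `-y` are junk-harmonic while their sum `x²/2` is not:
`RoughMetric.not_mem_harmonicForms_iff`, `not_forall_mem_harmonicForms_iff`; canonical closure
`not_mem_harmonicForms_iff` in `RiemannianHodgeHarmonicRefutation.lean`), and for smooth metrics
it is **true** (`mem_harmonicForms_iff_of_contMDiffMetric`). This file binds the two intended
instances *inside* a closed statement and discharges it; nothing new is proved.

## Main statements

* `Literature.Geometry.Kaehler.mem_harmonicForms_iff_of_isContMDiffRiemannianBundle` — the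
  corrected, closed named fact;
* `Literature.Geometry.Kaehler.mem_harmonicForms_iff_of_isContMDiffRiemannianBundle_holds` — its
  discharge, by `mem_harmonicForms_iff_of_contMDiffMetric`.

## References

* F. W. Warner, *Foundations of Differentiable Manifolds and Lie Groups*, GTM 94, Springer
  (1983): 6.1, p. 220 (`Δ` a linear operator on `E^p(M)`); Def. 6.7, p. 222 (`H^p`); 4.10,
  p. 149 (metrics are smooth).
-/

noncomputable section

open scoped Manifold ContDiff
open Bundle Module

namespace Literature.Geometry.Kaehler

/-- **The harmonic forms of a Riemannian manifold form a linear subspace — corrected, closed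
statement of the predicate `Literature.Geometry.Kaehler.mem_harmonicForms_iff`**
(`RiemannianHodge.lean`). On a `C^∞` manifold `M` (`[IsManifold I ∞ M]`) with a `C^∞` Riemannian
metric (`[IsContMDiffRiemannianBundle I ∞ E (fun x : M ↦ TangentSpace I x)]`) and an orientation
family `o` with smooth volume form, for all degrees `k + m = n` and every `k`-form `α`:
`α ∈ harmonicForms o h ↔ IsHarmonicForm o h α` — the `ℝ`-span of the harmonic forms
`{α smooth | Δα = 0}` is that set itself, because `Δ = dδ + δd` is linear on the smooth `k`-forms
(Warner, GTM 94, 6.1, p. 220: "`Δ = δd + dδ` … is a linear operator on `E^p(M)` for each `p` with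
`0 ≤ p ≤ n`"; Def. 6.7, p. 222: `H^p = {ω ∈ E^p(M) : Δω = 0}`, "the elements of `H^p` are called
harmonic `p`-forms").

Discrepancy with the predicate: `mem_harmonicForms_iff o` speaks of the ambient fibre metric
`[RiemannianBundle _]` of no regularity (and of a bare charted space `M`), for which the closed
statement is false (`not_mem_harmonicForms_iff`, `RiemannianHodgeHarmonicRefutation.lean`: for a
rough metric `⋆` of a smooth form need not be differentiable, the `fderivWithin`-based `d` then
returns junk zeros, and additivity of `Δ` on smooth forms is lost). Here Warner's standing
hypotheses — `M` a `C^∞` manifold, the metric `C^∞` — are binders *of the statement*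
(`IsContinuousRiemannianBundle` is not needed). Discharged by
`mem_harmonicForms_iff_of_isContMDiffRiemannianBundle_holds`; the usable forms are the bridge
`Literature.Geometry.Kaehler.mem_harmonicForms_iff_of_contMDiffMetric`
(`RiemannianHodgeSmoothProofs.lean`) and, metric-agnostically, the relative discharge
`Literature.Geometry.Kaehler.mem_harmonicForms_iff_of_facts` (`RiemannianHodgeHarmonic.lean`).
[cite: WarnerGTM94, 6.1 (p. 220) and Def. 6.7 (p. 222)] -/
def mem_harmonicForms_iff_of_isContMDiffRiemannianBundle : Prop :=
  ∀ {E : Type*} [NormedAddCommGroup E] [NormedSpace ℝ E] {n : ℕ} [Fact (finrank ℝ E = n)]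
    {H : Type*} [TopologicalSpace H] {I : ModelWithCorners ℝ E H}
    {M : Type*} [TopologicalSpace M] [ChartedSpace H M] [IsManifold I ∞ M]
    [FiniteDimensional ℝ E] [RiemannianBundle (fun x : M ↦ TangentSpace I x)]
    [IsContMDiffRiemannianBundle I ∞ E (fun x : M ↦ TangentSpace I x)] {k m : ℕ}
    (o : (x : M) → Orientation ℝ (TangentSpace I x) (Fin n)),
    IsSmoothForm (riemannianVolumeForm o) → ∀ (h : k + m = n) (α : MForm I M ℝ k),
      α ∈ harmonicForms o h ↔ IsHarmonicForm o h α

/-- **Discharge** of `mem_harmonicForms_iff_of_isContMDiffRiemannianBundle` (the corrected,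
closed form of the predicate `mem_harmonicForms_iff`): immediate from the bridge
`mem_harmonicForms_iff_of_contMDiffMetric` (`RiemannianHodgeSmoothProofs.lean`), i.e. from the
relative discharge `mem_harmonicForms_iff_of_facts` fed chart independence of `d`
(`inChart_mextDeriv_holds`) and smoothness of `⋆` on smooth forms
(`isSmoothForm_hodgeStar_of_contMDiffMetric`, Warner 4.10 (6)). Warner (1983), 6.1, p. 220 and
Def. 6.7, p. 222. [cite: WarnerGTM94, 6.1 (p. 220) and Def. 6.7 (p. 222)] -/
theorem mem_harmonicForms_iff_of_isContMDiffRiemannianBundle_holds :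
    mem_harmonicForms_iff_of_isContMDiffRiemannianBundle :=
  fun o ho h α ↦ mem_harmonicForms_iff_of_contMDiffMetric o ho h α

end Literature.Geometry.Kaehler
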